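import Summits.QuantumFields.YangMills.Theorems.HyperbolicToTorus.Negative.ChartRigidityCore

/-!
# `HyperbolicToTorus` (stmt-QuantumFields-15827) — negative side: chart rigidity of the admissibility predicate

Support file for crux `stmt-QuantumFields-15827`
(`Summit.QuantumFields.YangMills.Theses.HyperbolicRegulator.HyperbolicToTorus`), extracted from the standing
disprover's work file `Cruxes/HyperbolicToTorus/Disproof.lean` (§3, the VACUITY THREAT). Pure combinatorics of
finite square complexes (Mathlib only; nothing posited; no `def`; nothing here asserts a Theses statement).

The three cruxes `CurvatureAnchor`, `CurvatureUniformity`, `HyperbolicToTorus` of route `HyperbolicRegulator`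
share ONE inlined vocabulary `let Fam := …` whose first component — admissibility of the member `(k, j)` of a
hyperbolic family — is the conjunction A1–A9: A2 squares have a closed oriented boundary with four distinct
corners, A3 every edge lies in exactly two squares, A4 every vertex has degree `dg ∈ {4, 5}` and is a corner of
exactly `dg` squares, A9 every FLAT vertex `x` (`F x`: all cones `c`, `dg c = 5`, at graph distance `> k/4`)
carries a chart: an injective map `cV x` of the `ℓ^∞`-box `{|a.1|, |a.2| ≤ k/4}` of `ℤ²` into `V` with
`cV x (0,0) = x`, consecutive box points joined by edges `cE x a μ`, unit cells realised by squares.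

* (part I, `Negative/ChartRigidityCore.lean`: `card_edges_eq_four_of_saturated` — four distinct edges at `y`
  whose squares all lie in a set of `≤ 4` squares force `dg y = 4`.)
* `card_edges_eq_four_of_chart` — **chart rigidity**: under A2–A4 and the chart clauses of A9, every vertex
  charted at an INTERIOR box position (`|a.1|, |a.2| ≤ R - 1`) has degree `4`; no cone strictly inside a chart.
* `adm_chart_interior_degree_four` — the same in the VERBATIM `let`-shape of the route's conjuncts (feed it
  `h.2.1`, `h.2.2.1`, `h.2.2.2.1` of `(Fam k j …).1` and the A9 conjunction at a flat `x`).

CONSEQUENCE (work file §3). `F` measures cones in GRAPH (`ℓ¹`) distance `> k/4` but the chart is the `ℓ^∞` box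
of radius `k/4`, whose far corner sits at graph distance `2·(k/4)`. In the route's intended witness
(k-subdivided `{4,5}` square complexes: flat `k × k` big squares, five at each cone) the vertex at offset
`(2, k/4 - 1)` from a cone inside a big square is flat (graph distance `k/4 + 1`), its chart is forced to be the
flat development (interior chart vertices have degree 4 and their four neighbours are the charted ones), and that
development places the cone at the interior position `(-2, -(k/4 - 1))` — contradiction for every `k ≥ 12`.
So the intended family is NOT admissible as typed; unless an exotic admissible family exists, `CurvatureAnchor`
is false as stated and `CurvatureUniformity` / `HyperbolicToTorus` are vacuously true. Minimal repair of the
shared vocabulary: `F := fun x => x ∈ V ∧ ∀ c ∈ K, k / 2 < Γ.dist x c` (the box of radius `k/4` then stays at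
graph distance `≤ k/2` from its centre), or charts of radius `k/8` with supports `k/16`.
-/

namespace Summit.QuantumFields.YangMills.Theorems.HyperbolicToTorus.Negative

open Finset Function

/-! ### Chart rigidity -/

section Chart

/-- **Chart rigidity.** In a square complex with A2 (squares have four distinct corners and a closed
oriented boundary), A3 (every edge lies in exactly two squares) and A4 (at each vertex the number of
squares cornered there equals its degree `∈ {4, 5}`), let `c`, `cE` be a vertex/edge chart of the box
`[-R, R]²` as in conjunct A9 of the route's admissibility predicate (injective on the box, consecutive
box points joined by the charted edges, unit cells realised by squares with the charted boundary).
Then every vertex charted at an INTERIOR position (`|a.1|, |a.2| ≤ R - 1`) has degree exactly `4`: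
the four charted edges at it are distinct, each already lies in two distinct charted squares, so a
fifth square cornered there would need two further edges. In particular no degree-`5` vertex (cone) is
charted strictly inside a chart. [folklore] -/
theorem card_edges_eq_four_of_chart
    {V E Q : Finset ℕ} {σ τ : ℕ → ℕ} {bd : ℕ → Fin 4 → ℕ × Bool}
    {c : ℤ × ℤ → ℕ} {cE : ℤ × ℤ → Fin 2 → ℕ × Bool} {R : ℤ}
    (hA2 : ∀ q ∈ Q, (∀ i, (bd q i).1 ∈ E) ∧
      (∀ i, (if (bd q i).2 then τ (bd q i).1 else σ (bd q i).1) =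
        (if (bd q (i + 1)).2 then σ (bd q (i + 1)).1 else τ (bd q (i + 1)).1)) ∧
      Function.Injective (fun i => if (bd q i).2 then σ (bd q i).1 else τ (bd q i).1))
    (hA3 : ∀ e ∈ E, (Q.filter fun q => ∃ i, (bd q i).1 = e).card = 2)
    (hA4 : ∀ x ∈ V, ((E.filter fun e => σ e = x ∨ τ e = x).card = 4 ∨
        (E.filter fun e => σ e = x ∨ τ e = x).card = 5) ∧
      (Q.filter fun q => ∃ i, (if (bd q i).2 then σ (bd q i).1 else τ (bd q i).1) = x).card =
        (E.filter fun e => σ e = x ∨ τ e = x).card)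
    (hcV : ∀ a : ℤ × ℤ, |a.1| ≤ R ∧ |a.2| ≤ R → c a ∈ V)
    (hinj : Set.InjOn c {a : ℤ × ℤ | |a.1| ≤ R ∧ |a.2| ≤ R})
    (hcE0 : ∀ a : ℤ × ℤ, |a.1| ≤ R ∧ |a.2| ≤ R → |a.1 + 1| ≤ R ∧ |a.2| ≤ R →
      (cE a 0).1 ∈ E ∧ (if (cE a 0).2 then σ (cE a 0).1 else τ (cE a 0).1) = c a ∧
        (if (cE a 0).2 then τ (cE a 0).1 else σ (cE a 0).1) = c (a.1 + 1, a.2))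
    (hcE1 : ∀ a : ℤ × ℤ, |a.1| ≤ R ∧ |a.2| ≤ R → |a.1| ≤ R ∧ |a.2 + 1| ≤ R →
      (cE a 1).1 ∈ E ∧ (if (cE a 1).2 then σ (cE a 1).1 else τ (cE a 1).1) = c a ∧
        (if (cE a 1).2 then τ (cE a 1).1 else σ (cE a 1).1) = c (a.1, a.2 + 1))
    (hsq : ∀ a : ℤ × ℤ, |a.1| ≤ R ∧ |a.2| ≤ R → |a.1 + 1| ≤ R ∧ |a.2 + 1| ≤ R →
      ∃ q ∈ Q, Finset.univ.image (Prod.fst ∘ bd q) =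
        {(cE a 0).1, (cE (a.1 + 1, a.2) 1).1, (cE (a.1, a.2 + 1) 0).1, (cE a 1).1})
    {a : ℤ × ℤ} (ha1 : |a.1| ≤ R - 1) (ha2 : |a.2| ≤ R - 1) :
    (E.filter fun e => σ e = c a ∨ τ e = c a).card = 4 := by
  obtain ⟨l1, u1⟩ := abs_le.1 ha1
  obtain ⟨l2, u2⟩ := abs_le.1 ha2
  have bx : ∀ {x y : ℤ}, -R ≤ x → x ≤ R → -R ≤ y → y ≤ R → |x| ≤ R ∧ |y| ≤ R :=
    fun h1 h2 h3 h4 => ⟨abs_le.2 ⟨h1, h2⟩, abs_le.2 ⟨h3, h4⟩⟩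
  -- the nine chart positions around `a` lie in the box
  have ba : |a.1| ≤ R ∧ |a.2| ≤ R := (bx (x := a.1) (y := a.2) (by omega) (by omega) (by omega) (by omega))
  have bR : |((a.1 + 1, a.2) : ℤ × ℤ).1| ≤ R ∧ |((a.1 + 1, a.2) : ℤ × ℤ).2| ≤ R := (bx (x := a.1 + 1) (y := a.2) (by omega) (by omega) (by omega) (by omega))
  have bU : |((a.1, a.2 + 1) : ℤ × ℤ).1| ≤ R ∧ |((a.1, a.2 + 1) : ℤ × ℤ).2| ≤ R := (bx (x := a.1) (y := a.2 + 1) (by omega) (by omega) (by omega) (by omega))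
  have bL : |((a.1 - 1, a.2) : ℤ × ℤ).1| ≤ R ∧ |((a.1 - 1, a.2) : ℤ × ℤ).2| ≤ R := (bx (x := a.1 - 1) (y := a.2) (by omega) (by omega) (by omega) (by omega))
  have bD : |((a.1, a.2 - 1) : ℤ × ℤ).1| ≤ R ∧ |((a.1, a.2 - 1) : ℤ × ℤ).2| ≤ R := (bx (x := a.1) (y := a.2 - 1) (by omega) (by omega) (by omega) (by omega))
  have bRU : |((a.1 + 1, a.2 + 1) : ℤ × ℤ).1| ≤ R ∧ |((a.1 + 1, a.2 + 1) : ℤ × ℤ).2| ≤ R := (bx (x := a.1 + 1) (y := a.2 + 1) (by omega) (by omega) (by omega) (by omega))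
  have bLU : |((a.1 - 1, a.2 + 1) : ℤ × ℤ).1| ≤ R ∧ |((a.1 - 1, a.2 + 1) : ℤ × ℤ).2| ≤ R := (bx (x := a.1 - 1) (y := a.2 + 1) (by omega) (by omega) (by omega) (by omega))
  have bRD : |((a.1 + 1, a.2 - 1) : ℤ × ℤ).1| ≤ R ∧ |((a.1 + 1, a.2 - 1) : ℤ × ℤ).2| ≤ R := (bx (x := a.1 + 1) (y := a.2 - 1) (by omega) (by omega) (by omega) (by omega))
  have bLD : |((a.1 - 1, a.2 - 1) : ℤ × ℤ).1| ≤ R ∧ |((a.1 - 1, a.2 - 1) : ℤ × ℤ).2| ≤ R := (bx (x := a.1 - 1) (y := a.2 - 1) (by omega) (by omega) (by omega) (by omega))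
  -- injectivity of the chart on the box, as inequalities of charted vertices
  have vne : ∀ {P P' : ℤ × ℤ}, (|P.1| ≤ R ∧ |P.2| ≤ R) → (|P'.1| ≤ R ∧ |P'.2| ≤ R) → P ≠ P' →
      c P ≠ c P' := fun hP hP' h => hinj.ne hP hP' h
  have nR_a : c (a.1 + 1, a.2) ≠ c a := vne bR ba (by simp only [ne_eq, Prod.ext_iff]; omega)
  have nR_U : c (a.1 + 1, a.2) ≠ c (a.1, a.2 + 1) := vne bR bU (by simp only [ne_eq, Prod.ext_iff]; omega)
  have nR_L : c (a.1 + 1, a.2) ≠ c (a.1 - 1, a.2) := vne bR bL (by simp only [ne_eq, Prod.ext_iff]; omega)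
  have nR_D : c (a.1 + 1, a.2) ≠ c (a.1, a.2 - 1) := vne bR bD (by simp only [ne_eq, Prod.ext_iff]; omega)
  have nU_a : c (a.1, a.2 + 1) ≠ c a := vne bU ba (by simp only [ne_eq, Prod.ext_iff]; omega)
  have nU_L : c (a.1, a.2 + 1) ≠ c (a.1 - 1, a.2) := vne bU bL (by simp only [ne_eq, Prod.ext_iff]; omega)
  have nU_D : c (a.1, a.2 + 1) ≠ c (a.1, a.2 - 1) := vne bU bD (by simp only [ne_eq, Prod.ext_iff]; omega)
  have nL_a : c (a.1 - 1, a.2) ≠ c a := vne bL ba (by simp only [ne_eq, Prod.ext_iff]; omega)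
  have nL_D : c (a.1 - 1, a.2) ≠ c (a.1, a.2 - 1) := vne bL bD (by simp only [ne_eq, Prod.ext_iff]; omega)
  have nL_RU : c (a.1 - 1, a.2) ≠ c (a.1 + 1, a.2 + 1) := vne bL bRU (by simp only [ne_eq, Prod.ext_iff]; omega)
  have nD_RU : c (a.1, a.2 - 1) ≠ c (a.1 + 1, a.2 + 1) := vne bD bRU (by simp only [ne_eq, Prod.ext_iff]; omega)
  have nD_LU : c (a.1, a.2 - 1) ≠ c (a.1 - 1, a.2 + 1) := vne bD bLU (by simp only [ne_eq, Prod.ext_iff]; omega)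
  have nL_RD : c (a.1 - 1, a.2) ≠ c (a.1 + 1, a.2 - 1) := vne bL bRD (by simp only [ne_eq, Prod.ext_iff]; omega)
  have nD_a : c (a.1, a.2 - 1) ≠ c a := vne bD ba (by simp only [ne_eq, Prod.ext_iff]; omega)
  -- the charted edges around `c a`, with their endpoint pairs
  have pr : ∀ {e : ℕ × Bool} {u v : ℕ}, (if e.2 then σ e.1 else τ e.1) = u →
      (if e.2 then τ e.1 else σ e.1) = v → ({σ e.1, τ e.1} : Finset ℕ) = {u, v} :=
    fun hs he => by rw [pair_eq_st_en σ τ, hs, he]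
  obtain ⟨eRE, eRs, eRe⟩ := hcE0 a ba (bx (x := a.1 + 1) (y := a.2) (by omega) (by omega) (by omega) (by omega))
  have eRp : ({σ (cE a 0).1, τ (cE a 0).1} : Finset ℕ) = {c a, c (a.1 + 1, a.2)} := pr eRs eRe
  obtain ⟨eUE, eUs, eUe⟩ := hcE1 a ba (bx (x := a.1) (y := a.2 + 1) (by omega) (by omega) (by omega) (by omega))
  have eUp : ({σ (cE a 1).1, τ (cE a 1).1} : Finset ℕ) = {c a, c (a.1, a.2 + 1)} := pr eUs eUe
  obtain ⟨eLE, eLs, eLe⟩ := hcE0 (a.1 - 1, a.2) bL (bx (x := a.1 - 1 + 1) (y := a.2) (by omega) (by omega) (by omega) (by omega))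
  simp only [sub_add_cancel, Prod.mk.eta] at eLe
  have eLp : ({σ (cE (a.1 - 1, a.2) 0).1, τ (cE (a.1 - 1, a.2) 0).1} : Finset ℕ) = {c (a.1 - 1, a.2), c a} := pr eLs eLe
  obtain ⟨eDE, eDs, eDe⟩ := hcE1 (a.1, a.2 - 1) bD (bx (x := a.1) (y := a.2 - 1 + 1) (by omega) (by omega) (by omega) (by omega))
  simp only [sub_add_cancel, Prod.mk.eta] at eDe
  have eDp : ({σ (cE (a.1, a.2 - 1) 1).1, τ (cE (a.1, a.2 - 1) 1).1} : Finset ℕ) = {c (a.1, a.2 - 1), c a} := pr eDs eDe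
  obtain ⟨f1E, f1s, f1e⟩ := hcE1 (a.1 + 1, a.2) bR (bx (x := a.1 + 1) (y := a.2 + 1) (by omega) (by omega) (by omega) (by omega))
  dsimp only at f1e
  have f1p : ({σ (cE (a.1 + 1, a.2) 1).1, τ (cE (a.1 + 1, a.2) 1).1} : Finset ℕ) = {c (a.1 + 1, a.2), c (a.1 + 1, a.2 + 1)} := pr f1s f1e
  obtain ⟨f2E, f2s, f2e⟩ := hcE0 (a.1, a.2 + 1) bU (bx (x := a.1 + 1) (y := a.2 + 1) (by omega) (by omega) (by omega) (by omega))
  dsimp only at f2e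
  have f2p : ({σ (cE (a.1, a.2 + 1) 0).1, τ (cE (a.1, a.2 + 1) 0).1} : Finset ℕ) = {c (a.1, a.2 + 1), c (a.1 + 1, a.2 + 1)} := pr f2s f2e
  obtain ⟨g2E, g2s, g2e⟩ := hcE0 (a.1 - 1, a.2 + 1) bLU (bx (x := a.1 - 1 + 1) (y := a.2 + 1) (by omega) (by omega) (by omega) (by omega))
  simp only [sub_add_cancel] at g2e
  have g2p : ({σ (cE (a.1 - 1, a.2 + 1) 0).1, τ (cE (a.1 - 1, a.2 + 1) 0).1} : Finset ℕ) = {c (a.1 - 1, a.2 + 1), c (a.1, a.2 + 1)} := pr g2s g2e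
  obtain ⟨g2pE, g2ps, g2pe⟩ := hcE1 (a.1 - 1, a.2) bL (bx (x := a.1 - 1) (y := a.2 + 1) (by omega) (by omega) (by omega) (by omega))
  dsimp only at g2pe
  have g2pp : ({σ (cE (a.1 - 1, a.2) 1).1, τ (cE (a.1 - 1, a.2) 1).1} : Finset ℕ) = {c (a.1 - 1, a.2), c (a.1 - 1, a.2 + 1)} := pr g2ps g2pe
  obtain ⟨g4E, g4s, g4e⟩ := hcE0 (a.1, a.2 - 1) bD (bx (x := a.1 + 1) (y := a.2 - 1) (by omega) (by omega) (by omega) (by omega))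
  dsimp only at g4e
  have g4p : ({σ (cE (a.1, a.2 - 1) 0).1, τ (cE (a.1, a.2 - 1) 0).1} : Finset ℕ) = {c (a.1, a.2 - 1), c (a.1 + 1, a.2 - 1)} := pr g4s g4e
  obtain ⟨g4pE, g4ps, g4pe⟩ := hcE1 (a.1 + 1, a.2 - 1) bRD (bx (x := a.1 + 1) (y := a.2 - 1 + 1) (by omega) (by omega) (by omega) (by omega))
  simp only [sub_add_cancel] at g4pe
  have g4pp : ({σ (cE (a.1 + 1, a.2 - 1) 1).1, τ (cE (a.1 + 1, a.2 - 1) 1).1} : Finset ℕ) = {c (a.1 + 1, a.2 - 1), c (a.1 + 1, a.2)} := pr g4ps g4pe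
  -- membership / non-membership of charted vertices in endpoint pairs
  have ene : ∀ {e e' u v u' v' w : ℕ}, ({σ e, τ e} : Finset ℕ) = {u, v} →
      ({σ e', τ e'} : Finset ℕ) = {u', v'} → w ∈ ({u, v} : Finset ℕ) → w ∉ ({u', v'} : Finset ℕ) →
      e ≠ e' := by
    intro e e' u v u' v' w hp hp' hw hw' heq
    subst heq
    rw [← hp, hp'] at hw
    exact hw' hw
  have mem1 : ∀ {u v : ℕ}, u ∈ ({u, v} : Finset ℕ) := by simp
  have mem2 : ∀ {u v : ℕ}, v ∈ ({u, v} : Finset ℕ) := by simp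
  have nmem : ∀ {w u v : ℕ}, w ≠ u → w ≠ v → w ∉ ({u, v} : Finset ℕ) := by
    intro w u v h1 h2; simp [h1, h2]
  have aty : ∀ {e u v : ℕ}, ({σ e, τ e} : Finset ℕ) = {u, v} → c a ∈ ({u, v} : Finset ℕ) →
      σ e = c a ∨ τ e = c a := by
    intro e u v h hca
    rw [← h] at hca
    simp only [Finset.mem_insert, Finset.mem_singleton] at hca
    rcases hca with h1 | h1
    · exact Or.inl h1.symm
    · exact Or.inr h1.symm
  have yR := aty eRp mem1
  have yU := aty eUp mem1
  have yL := aty eLp mem2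
  have yD := aty eDp mem2
  have hRU : (cE a 0).1 ≠ (cE a 1).1 :=
    ene eRp eUp mem2 (nmem nR_a nR_U)
  have hRL : (cE a 0).1 ≠ (cE (a.1 - 1, a.2) 0).1 :=
    ene eRp eLp mem2 (nmem nR_L nR_a)
  have hRD : (cE a 0).1 ≠ (cE (a.1, a.2 - 1) 1).1 :=
    ene eRp eDp mem2 (nmem nR_D nR_a)
  have hUL : (cE a 1).1 ≠ (cE (a.1 - 1, a.2) 0).1 :=
    ene eUp eLp mem2 (nmem nU_L nU_a)
  have hUD : (cE a 1).1 ≠ (cE (a.1, a.2 - 1) 1).1 :=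
    ene eUp eDp mem2 (nmem nU_D nU_a)
  have hLD : (cE (a.1 - 1, a.2) 0).1 ≠ (cE (a.1, a.2 - 1) 1).1 :=
    ene eLp eDp mem1 (nmem nL_D nL_a)
  have hLR : (cE (a.1 - 1, a.2) 0).1 ≠ (cE a 0).1 :=
    ene eLp eRp mem1 (nmem nL_a nR_L.symm)
  have hLf1 : (cE (a.1 - 1, a.2) 0).1 ≠ (cE (a.1 + 1, a.2) 1).1 :=
    ene eLp f1p mem1 (nmem nR_L.symm nL_RU)
  have hLf2 : (cE (a.1 - 1, a.2) 0).1 ≠ (cE (a.1, a.2 + 1) 0).1 :=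
    ene eLp f2p mem1 (nmem nU_L.symm nL_RU)
  have hLU : (cE (a.1 - 1, a.2) 0).1 ≠ (cE a 1).1 :=
    ene eLp eUp mem1 (nmem nL_a nU_L.symm)
  have hDR : (cE (a.1, a.2 - 1) 1).1 ≠ (cE a 0).1 :=
    ene eDp eRp mem1 (nmem nD_a nR_D.symm)
  have hDf1 : (cE (a.1, a.2 - 1) 1).1 ≠ (cE (a.1 + 1, a.2) 1).1 :=
    ene eDp f1p mem1 (nmem nR_D.symm nD_RU)
  have hDf2 : (cE (a.1, a.2 - 1) 1).1 ≠ (cE (a.1, a.2 + 1) 0).1 :=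
    ene eDp f2p mem1 (nmem nU_D.symm nD_RU)
  have hDU : (cE (a.1, a.2 - 1) 1).1 ≠ (cE a 1).1 :=
    ene eDp eUp mem1 (nmem nD_a nU_D.symm)
  have hDL : (cE (a.1, a.2 - 1) 1).1 ≠ (cE (a.1 - 1, a.2) 0).1 :=
    ene eDp eLp mem1 (nmem nL_D.symm nD_a)
  have hDg2 : (cE (a.1, a.2 - 1) 1).1 ≠ (cE (a.1 - 1, a.2 + 1) 0).1 :=
    ene eDp g2p mem1 (nmem nD_LU nU_D.symm)
  have hDg2p : (cE (a.1, a.2 - 1) 1).1 ≠ (cE (a.1 - 1, a.2) 1).1 :=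
    ene eDp g2pp mem1 (nmem nL_D.symm nD_LU)
  have hLg4 : (cE (a.1 - 1, a.2) 0).1 ≠ (cE (a.1, a.2 - 1) 0).1 :=
    ene eLp g4p mem1 (nmem nL_D nL_RD)
  have hLg4p : (cE (a.1 - 1, a.2) 0).1 ≠ (cE (a.1 + 1, a.2 - 1) 1).1 :=
    ene eLp g4pp mem1 (nmem nL_RD nR_L.symm)
  -- the four charted squares around `c a`
  obtain ⟨q1, q1Q, q1i⟩ := hsq a ba (bx (x := a.1 + 1) (y := a.2 + 1) (by omega) (by omega) (by omega) (by omega))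
  obtain ⟨q2, q2Q, q2i⟩ := hsq (a.1 - 1, a.2) bL (bx (x := a.1 - 1 + 1) (y := a.2 + 1) (by omega) (by omega) (by omega) (by omega))
  simp only [sub_add_cancel, Prod.mk.eta] at q2i
  obtain ⟨q3, q3Q, q3i⟩ := hsq (a.1 - 1, a.2 - 1) bLD (bx (x := a.1 - 1 + 1) (y := a.2 - 1 + 1) (by omega) (by omega) (by omega) (by omega))
  simp only [sub_add_cancel] at q3i
  obtain ⟨q4, q4Q, q4i⟩ := hsq (a.1, a.2 - 1) bD (bx (x := a.1 + 1) (y := a.2 - 1 + 1) (by omega) (by omega) (by omega) (by omega))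
  simp only [sub_add_cancel, Prod.mk.eta] at q4i
  have xim : ∀ {q e : ℕ}, e ∈ Finset.univ.image (Prod.fst ∘ bd q) → ∃ i, (bd q i).1 = e := by
    intro q e h
    obtain ⟨i, -, hi⟩ := Finset.mem_image.1 h
    exact ⟨i, hi⟩
  have xR1 : ∃ i, (bd q1 i).1 = (cE a 0).1 := xim (by rw [q1i]; simp)
  have xU1 : ∃ i, (bd q1 i).1 = (cE a 1).1 := xim (by rw [q1i]; simp)
  have xL2 : ∃ i, (bd q2 i).1 = (cE (a.1 - 1, a.2) 0).1 := xim (by rw [q2i]; simp)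
  have xU2 : ∃ i, (bd q2 i).1 = (cE a 1).1 := xim (by rw [q2i]; simp)
  have xL3 : ∃ i, (bd q3 i).1 = (cE (a.1 - 1, a.2) 0).1 := xim (by rw [q3i]; simp)
  have xD3 : ∃ i, (bd q3 i).1 = (cE (a.1, a.2 - 1) 1).1 := xim (by rw [q3i]; simp)
  have xD4 : ∃ i, (bd q4 i).1 = (cE (a.1, a.2 - 1) 1).1 := xim (by rw [q4i]; simp)
  have xR4 : ∃ i, (bd q4 i).1 = (cE a 0).1 := xim (by rw [q4i]; simp)
  have nL1 : (cE (a.1 - 1, a.2) 0).1 ∉ Finset.univ.image (Prod.fst ∘ bd q1) := by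
    rw [q1i]; simp only [Finset.mem_insert, Finset.mem_singleton, not_or]; exact ⟨hLR, hLf1, hLf2, hLU⟩
  have nD1 : (cE (a.1, a.2 - 1) 1).1 ∉ Finset.univ.image (Prod.fst ∘ bd q1) := by
    rw [q1i]; simp only [Finset.mem_insert, Finset.mem_singleton, not_or]; exact ⟨hDR, hDf1, hDf2, hDU⟩
  have nD2 : (cE (a.1, a.2 - 1) 1).1 ∉ Finset.univ.image (Prod.fst ∘ bd q2) := by
    rw [q2i]; simp only [Finset.mem_insert, Finset.mem_singleton, not_or]; exact ⟨hDL, hDU, hDg2, hDg2p⟩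
  have nL4 : (cE (a.1 - 1, a.2) 0).1 ∉ Finset.univ.image (Prod.fst ∘ bd q4) := by
    rw [q4i]; simp only [Finset.mem_insert, Finset.mem_singleton, not_or]; exact ⟨hLg4, hLg4p, hLR, hLD⟩
  have mL2 : (cE (a.1 - 1, a.2) 0).1 ∈ Finset.univ.image (Prod.fst ∘ bd q2) := by rw [q2i]; simp
  have mD3 : (cE (a.1, a.2 - 1) 1).1 ∈ Finset.univ.image (Prod.fst ∘ bd q3) := by rw [q3i]; simp
  have mD4 : (cE (a.1, a.2 - 1) 1).1 ∈ Finset.univ.image (Prod.fst ∘ bd q4) := by rw [q4i]; simp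
  have mL3 : (cE (a.1 - 1, a.2) 0).1 ∈ Finset.univ.image (Prod.fst ∘ bd q3) := by rw [q3i]; simp
  have h12 : q1 ≠ q2 := fun h => nL1 (h ▸ mL2)
  have h14 : q1 ≠ q4 := fun h => nD1 (h ▸ mD4)
  have h23 : q2 ≠ q3 := fun h => nD2 (h ▸ mD3)
  have h34 : q3 ≠ q4 := fun h => nL4 (h ▸ mL3)
  -- assemble
  obtain ⟨hdeg, hcount⟩ := hA4 (c a) (hcV a ba)
  have hCh4 : ({(cE a 0).1, (cE a 1).1, (cE (a.1 - 1, a.2) 0).1, (cE (a.1, a.2 - 1) 1).1} :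
      Finset ℕ).card = 4 := by
    rw [Finset.card_insert_of_notMem (by simp [hRU, hRL, hRD]),
      Finset.card_insert_of_notMem (by simp [hUL, hUD]), Finset.card_pair hLD]
  have hChD : ({(cE a 0).1, (cE a 1).1, (cE (a.1 - 1, a.2) 0).1, (cE (a.1, a.2 - 1) 1).1} :
      Finset ℕ) ⊆ E.filter fun e => σ e = c a ∨ τ e = c a := by
    intro e he
    simp only [Finset.mem_insert, Finset.mem_singleton] at he
    rw [Finset.mem_filter]
    rcases he with rfl | rfl | rfl | rfl
    exacts [⟨eRE, yR⟩, ⟨eUE, yU⟩, ⟨eLE, yL⟩, ⟨eDE, yD⟩]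
  refine card_edges_eq_four_of_saturated hA2 (c a) _ {q1, q2, q3, q4} hdeg hcount hCh4 hChD
    Finset.card_le_four ?_
  intro e he q hq hqe
  simp only [Finset.mem_insert, Finset.mem_singleton] at he
  rcases he with rfl | rfl | rfl | rfl
  · rcases saturated_of_two hA3 eRE q1Q xR1 q4Q xR4 h14 hq hqe with rfl | rfl <;> simp
  · rcases saturated_of_two hA3 eUE q1Q xU1 q2Q xU2 h12 hq hqe with rfl | rfl <;> simp
  · rcases saturated_of_two hA3 eLE q2Q xL2 q3Q xL3 h23 hq hqe with rfl | rfl <;> simp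
  · rcases saturated_of_two hA3 eDE q3Q xD3 q4Q xD4 h34 hq hqe with rfl | rfl <;> simp

end Chart

/-! ### In the shape of the route's admissibility conjuncts -/

section Adm

/-- **Chart rigidity, in the verbatim shape of the route's `Fam` vocabulary.** For the admissibility
conjuncts A2, A3, A4 of `(Fam k j V E Q σ τ bd cV cE).1` (route `HyperbolicRegulator`, shared verbatim
by `CurvatureAnchor`, `CurvatureUniformity`, `HyperbolicToTorus`) and the chart clause A9 AT ONE flat
point `x` (the conjunction A9 delivers under `F x`), every vertex charted at an interior box position
`a` (`|a.1|, |a.2| ≤ k/4 - 1`) has degree `4`; in particular it is not a cone (`dg = 5`), although the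
flatness predicate `F` only keeps cones at GRAPH distance `> k/4` from `x` while the box reaches graph
distance `2 (k/4)`. [folklore] -/
theorem adm_chart_interior_degree_four (k : ℕ) (V E Q : Finset ℕ) (σ τ : ℕ → ℕ)
    (bd : ℕ → Fin 4 → ℕ × Bool) (cV : ℕ → ℤ × ℤ → ℕ) (cE : ℕ → ℤ × ℤ → Fin 2 → ℕ × Bool) :
    let st := fun e : ℕ × Bool => if e.2 then σ e.1 else τ e.1
    let en := fun e : ℕ × Bool => if e.2 then τ e.1 else σ e.1
    let dg := fun x : ℕ => (E.filter fun e => σ e = x ∨ τ e = x).card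
    let ib := fun a : ℤ × ℤ => |a.1| ≤ (k : ℤ) / 4 ∧ |a.2| ≤ (k : ℤ) / 4
    let nx := fun (a : ℤ × ℤ) (μ : Fin 2) => if μ = 0 then (a.1 + 1, a.2) else (a.1, a.2 + 1)
    (∀ q ∈ Q, (∀ i, (bd q i).1 ∈ E) ∧ (∀ i, en (bd q i) = st (bd q (i + 1))) ∧
      (st ∘ bd q).Injective) →
    (∀ e ∈ E, (Q.filter fun q => ∃ i, (bd q i).1 = e).card = 2) →
    (∀ x ∈ V, (dg x = 4 ∨ dg x = 5) ∧ (Q.filter fun q => ∃ i, st (bd q i) = x).card = dg x) →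
    ∀ x : ℕ, (cV x (0, 0) = x ∧ (∀ a, ib a → cV x a ∈ V) ∧ Set.InjOn (cV x) {a | ib a} ∧
      (∀ a μ, ib a → ib (nx a μ) → (cE x a μ).1 ∈ E ∧ st (cE x a μ) = cV x a ∧
        en (cE x a μ) = cV x (nx a μ)) ∧
      (∀ a, ib a → ib (a.1 + 1, a.2 + 1) → ∃ q ∈ Q, Finset.univ.image (Prod.fst ∘ bd q) =
        {(cE x a 0).1, (cE x (nx a 0) 1).1, (cE x (nx a 1) 0).1, (cE x a 1).1})) →
    ∀ a : ℤ × ℤ, |a.1| ≤ (k : ℤ) / 4 - 1 → |a.2| ≤ (k : ℤ) / 4 - 1 → dg (cV x a) = 4 := by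
  intro st en dg ib nx hA2 hA3 hA4 x hch a ha1 ha2
  obtain ⟨-, hcV, hinj, hcE, hsq⟩ := hch
  exact card_edges_eq_four_of_chart (R := (k : ℤ) / 4) hA2 hA3 hA4 hcV hinj
    (fun a h1 h2 => hcE a 0 h1 h2) (fun a h1 h2 => hcE a 1 h1 h2) (fun a h1 h2 => hsq a h1 h2) ha1 ha2

end Adm

end Summit.QuantumFields.YangMills.Theorems.HyperbolicToTorus.Negative
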